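import Literature.MathematicalPhysics.QuantumFieldTheory.Balaban1983to89.B1Eq324BenfattoSect5Iteration
import Literature.MathematicalPhysics.QuantumFieldTheory.Balaban1983to89.B1Eq324BenfattoMarkov
import HarnessLib

/-!
# `Balaban1983to89.B1Eq324BenfattoCondTranslation` — [BenfattoEtAl1978] p. 152 / §5 p. 159: the conditioned field `P̄ = P̂₀(·|z̄_C)` is TRANSLATION
# COVARIANT — translating the lattice by `s` turns `P̂₀(·|z̄_{C+s})` into `P̂₀(·|(z̄∘(·+s))_C)` (regression dictionary and law), PROVED; the bookkeeping
# lemma that lets the displaced pavements of the upper bound (4.6) (`C ≠ ∅`) be moved back to the standard one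

statement-level skeleton of published theorems with citation tags; proofs where landed; nothing here is a claim about the
Yang–Mills mass gap

WHY THIS MODULE (cell `pub-ymgap`, seat `dag-n08-d` gen 9, INTENT-38; node N08 [Balaban1985UV3]; the [BenfattoEtAl1978] source chain behind the
(α)-row `h324c`).  Print iterates over displaced pavements (p. 159 «choosing a new pavement Q′^b displaced by b²/2»); the tree's §5 modules are
stated for the standard pavement and `…Translation.P0_map_translate` / `…Sect5Iteration.integral_cutoffBoltzmann_translate` move a displaced
pavement back — for `P̂₀`.  For the upper bound (4.6) the measure is `P̄ = P̂₀(·|z̄_C)` (p. 152), whose translate is the conditioned field of the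
translated conditioning set: this file proves it, so that `…Sect5Eq536.upperPavementStep_cond_of_setIntegral` can be iterated.

WHAT IS PROVED (standard axioms; no `sorry`; no definition; `K = freeCov d α β`).
* §1 `covGram_image_add_eq_reindex` (`K_{(C+s)(C+s)}` is `K_CC` re-indexed by `imageAddEquiv`), `condMean_image_add` (`u_{C+s}(z̄)(x+s) = u_C(z̄∘(·+s))(x)`),
  `condCov_image_add` (`C^{C+s}(x+s, y+s) = C^C(x, y)`) — translation invariance of `K` (`…Translation.freeCov_add_right`) and `Matrix.inv_reindex`.
* §2 ★★ `condField_map_translate` — `(condField d α β (C.image (·+s)) z̄).map (z ↦ z∘(·+s)) = condField d α β C (z̄∘(·+s))` (`α, β > 0`; Gaussian laws are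
  determined by mean and covariance), ★ `integral_condField_comp_translate`.
HONEST SCOPE.  Bookkeeping only; count-neutral for N08; `BasicLemmaPrinted` NOT discharged; nothing about d = 4, the continuum, OS axioms, a mass gap
or the Clay problem.
-/

noncomputable section

open Finset MeasureTheory ProbabilityTheory Matrix
open scoped BigOperators Matrix

namespace Literature.MathematicalPhysics.QuantumFieldTheory.Balaban1983to89.B1Eq324BenfattoCondTranslation

open _root_.MeasureTheory
open Literature.MathematicalPhysics.QuantumFieldTheory
open Literature.MathematicalPhysics.QuantumFieldTheory.Balaban1983to89.B1Eq324BenfattoLemma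
open Literature.MathematicalPhysics.QuantumFieldTheory.Balaban1983to89.B1Eq324BenfattoTranslation
open Literature.MathematicalPhysics.QuantumFieldTheory.Balaban1983to89.B1Eq324BenfattoSect5Iteration (imageAddEquiv)
open Literature.MathematicalPhysics.QuantumFieldTheory.Balaban1983to89.B1Eq324BenfattoAppendixC2
open Literature.MathematicalPhysics.QuantumFieldTheory.Balaban1983to89.B1Eq324BenfattoAppendixCLemma2
open Literature.MathematicalPhysics.QuantumFieldTheory.Balaban1983to89.B1Eq324BenfattoMarkov

variable {d : ℕ} {α β : ℝ}

/-! ## §1  The regression dictionary under a translation of the conditioning set -/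

section Dictionary

/-- kernel: the value of `imageAddEquiv` and of its inverse. [folklore] -/
private theorem imageAddEquiv_symm_add (C : Finset (B1Eq324BenfattoLemma.Site d)) (s : B1Eq324BenfattoLemma.Site d)
    (i : ↥(C.image fun x => x + s)) : (((imageAddEquiv C s).symm i : C) : B1Eq324BenfattoLemma.Site d) + s = i := by
  have h := (imageAddEquiv C s).apply_symm_apply i
  have hv : ∀ c : C, ((imageAddEquiv C s c : ↥(C.image fun x => x + s)) : B1Eq324BenfattoLemma.Site d) = (c : B1Eq324BenfattoLemma.Site d) + s :=
    fun c => rfl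
  rw [← hv, h]

/-- **`K_{(C+s)(C+s)} = K_CC` re-indexed** (translation invariance of the free covariance). [cite: BenfattoEtAl1978, (1.1) p.144, Appendix C (C.7) p.164] -/
theorem covGram_image_add_eq_reindex (α β : ℝ) (C : Finset (B1Eq324BenfattoLemma.Site d)) (s : B1Eq324BenfattoLemma.Site d) :
    covGram (freeCov d α β) (C.image fun x => x + s) = Matrix.reindex (imageAddEquiv C s) (imageAddEquiv C s) (covGram (freeCov d α β) C) := by
  ext i j
  simp only [Matrix.reindex_apply, Matrix.submatrix_apply, covGram_apply]
  rw [← imageAddEquiv_symm_add C s i, ← imageAddEquiv_symm_add C s j, freeCov_add_right]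

/-- The inverse Gram matrix re-indexes the same way. [cite: BenfattoEtAl1978, Appendix C (C.7) p.164] -/
theorem covGram_image_add_inv_apply (α β : ℝ) (C : Finset (B1Eq324BenfattoLemma.Site d)) (s : B1Eq324BenfattoLemma.Site d) (c c' : C) :
    (covGram (freeCov d α β) (C.image fun x => x + s))⁻¹ (imageAddEquiv C s c) (imageAddEquiv C s c') = (covGram (freeCov d α β) C)⁻¹ c c' := by
  rw [covGram_image_add_eq_reindex, Matrix.inv_reindex]
  simp only [Matrix.reindex_apply, Matrix.submatrix_apply, Equiv.symm_apply_apply]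

/-- **The regression mean translates**: `u_{C+s}(z̄)(x + s) = u_C(z̄ ∘ (· + s))(x)`. [cite: BenfattoEtAl1978, Appendix C (C.7) p.164; §5 p.159] -/
theorem condMean_image_add (α β : ℝ) (C : Finset (B1Eq324BenfattoLemma.Site d)) (s : B1Eq324BenfattoLemma.Site d) (zbar : B1Eq324BenfattoLemma.Site d → ℝ)
    (x : B1Eq324BenfattoLemma.Site d) :
    condMean (freeCov d α β) (C.image fun x => x + s) zbar (x + s) = condMean (freeCov d α β) C (fun y => zbar (y + s)) x := by
  unfold condMean
  set e := imageAddEquiv C s with he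
  rw [← e.sum_comp]
  refine Finset.sum_congr rfl fun c _ => ?_
  rw [← e.sum_comp]
  refine Finset.sum_congr rfl fun c' _ => ?_
  have hc : ((e c : ↥(C.image fun x => x + s)) : B1Eq324BenfattoLemma.Site d) = (c : B1Eq324BenfattoLemma.Site d) + s := rfl
  have hc' : ((e c' : ↥(C.image fun x => x + s)) : B1Eq324BenfattoLemma.Site d) = (c' : B1Eq324BenfattoLemma.Site d) + s := rfl
  rw [hc, hc', freeCov_add_right, he, covGram_image_add_inv_apply]

/-- **The Dirichlet covariance translates**: `C^{C+s}(x + s, y + s) = C^C(x, y)`. [cite: BenfattoEtAl1978, Appendix C (C.6)–(C.7) p.164; §5 p.159] -/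
theorem condCov_image_add (α β : ℝ) (C : Finset (B1Eq324BenfattoLemma.Site d)) (s : B1Eq324BenfattoLemma.Site d) (x y : B1Eq324BenfattoLemma.Site d) :
    condCov (freeCov d α β) (C.image fun x => x + s) (x + s) (y + s) = condCov (freeCov d α β) C x y := by
  unfold condCov
  rw [freeCov_add_right]
  congr 1
  set e := imageAddEquiv C s with he
  rw [← e.sum_comp]
  refine Finset.sum_congr rfl fun c _ => ?_
  rw [← e.sum_comp]
  refine Finset.sum_congr rfl fun c' _ => ?_
  have hc : ((e c : ↥(C.image fun x => x + s)) : B1Eq324BenfattoLemma.Site d) = (c : B1Eq324BenfattoLemma.Site d) + s := rfl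
  have hc' : ((e c' : ↥(C.image fun x => x + s)) : B1Eq324BenfattoLemma.Site d) = (c' : B1Eq324BenfattoLemma.Site d) + s := rfl
  rw [hc, hc', freeCov_add_right, freeCov_add_right, he, covGram_image_add_inv_apply]

end Dictionary

/-! ## §2  The conditioned field translates -/

section Law

/-- kernel: translation of configurations is measurable. [folklore] -/
private theorem measurable_translate' (s : B1Eq324BenfattoLemma.Site d) :
    Measurable fun (z : B1Eq324BenfattoLemma.Site d → ℝ) (x : B1Eq324BenfattoLemma.Site d) => z (x + s) :=
  measurable_pi_lambda _ fun x => measurable_pi_apply (x + s)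

/-- **`P̂₀(·|z̄_{C+s})` TRANSLATED IS `P̂₀(·|(z̄∘(·+s))_C)`**: for `α, β > 0`, a finite `C`, a shift `s` and data `z̄`,
`(condField d α β (C + s) z̄) ∘ (z ↦ z∘(·+s))⁻¹ = condField d α β C (z̄∘(·+s))` — both are Gaussian with centre `u_C(z̄∘(·+s))` and covariance `C^C`
(§1), and a Gaussian law is determined by its mean and covariance (`eq_gaussianFieldOfKernel_of_isGaussianProcess` applied to the centred version).
[cite: BenfattoEtAl1978, p.152 «P̂₀(dz|(z̄_Δ)_{Δ∈C})», §5 p.159 «displaced pavement»] -/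
theorem condField_map_translate (hα : 0 < α) (hβ : 0 < β) (C : Finset (B1Eq324BenfattoLemma.Site d)) (s : B1Eq324BenfattoLemma.Site d)
    (zbar : B1Eq324BenfattoLemma.Site d → ℝ) :
    (condField d α β (C.image fun x => x + s) zbar).map (fun (z : B1Eq324BenfattoLemma.Site d → ℝ) (x : B1Eq324BenfattoLemma.Site d) => z (x + s))
      = condField d α β C (fun y => zbar (y + s)) := by
  set K := freeCov d α β with hK
  set C' : Finset (B1Eq324BenfattoLemma.Site d) := C.image fun x => x + s with hC'
  set μ := condField d α β C' zbar with hμ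
  haveI : IsProbabilityMeasure μ := isProbabilityMeasure_condField hα hβ C' zbar
  have hμG := isGaussianProcess_condField hα hβ C' zbar
  have hKc := isPosSemidefKernel_condCov_freeCov (d := d) hα hβ C
  set Q := gaussianFieldOfKernel (condCov K C) with hQ
  haveI : IsProbabilityMeasure Q := isProbabilityMeasure_gaussianFieldOfKernel hKc
  set u : B1Eq324BenfattoLemma.Site d → ℝ := condMean K C (fun y => zbar (y + s)) with hu
  have hu' : ∀ x, condMean K C' zbar (x + s) = u x := fun x => condMean_image_add α β C s zbar x
  -- the maps
  set τ : (B1Eq324BenfattoLemma.Site d → ℝ) → (B1Eq324BenfattoLemma.Site d → ℝ) := fun z x => z (x + s) with hτ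
  set Sm : (B1Eq324BenfattoLemma.Site d → ℝ) → (B1Eq324BenfattoLemma.Site d → ℝ) := fun z x => z x - u x with hSm
  set Sp : (B1Eq324BenfattoLemma.Site d → ℝ) → (B1Eq324BenfattoLemma.Site d → ℝ) := fun ζ x => condMean K C (fun y => zbar (y + s)) x + ζ x
    with hSp
  set Φ : (B1Eq324BenfattoLemma.Site d → ℝ) → (B1Eq324BenfattoLemma.Site d → ℝ) := fun z x => z (x + s) - u x with hΦ
  have hτm : Measurable τ := measurable_translate' s
  have hSmm : Measurable Sm := measurable_pi_lambda _ fun x => (measurable_pi_apply x).sub_const _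
  have hSpm : Measurable Sp := measurable_pi_lambda _ fun x => (measurable_pi_apply x).const_add _
  have hΦm : Measurable Φ := measurable_pi_lambda _ fun x => (measurable_pi_apply (x + s)).sub_const _
  have hΦeq : Φ = Sm ∘ τ := rfl
  -- the centred translate `ν = μ ∘ Φ⁻¹` is the Schur field `Q`
  set ν := μ.map Φ with hν
  haveI : IsProbabilityMeasure ν := Measure.isProbabilityMeasure_map hΦm.aemeasurable
  have hint : ∀ x, Integrable (fun z : B1Eq324BenfattoLemma.Site d → ℝ => z x) μ := fun x => (hμG.hasGaussianLaw_eval x).integrable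
  -- (i) Gaussian
  have hG : IsGaussianProcess (fun (x : B1Eq324BenfattoLemma.Site d) (ω : B1Eq324BenfattoLemma.Site d → ℝ) => ω x) ν := by
    have hτG : IsGaussianProcess (fun (x : B1Eq324BenfattoLemma.Site d) (z : B1Eq324BenfattoLemma.Site d → ℝ) => z (x + s)) μ :=
      hμG.comp_right fun x : B1Eq324BenfattoLemma.Site d => x + s
    refine ⟨fun I => ?_⟩
    have hGI : HasGaussianLaw (fun z : B1Eq324BenfattoLemma.Site d → ℝ => fun i : I => z ((i : B1Eq324BenfattoLemma.Site d) + s)) μ :=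
      hτG.hasGaussianLaw I
    have hrm : Measurable (fun z : B1Eq324BenfattoLemma.Site d → ℝ => I.restrict z) := Finset.measurable_restrict I
    have hRm : Measurable (fun z : B1Eq324BenfattoLemma.Site d → ℝ => fun i : I => z ((i : B1Eq324BenfattoLemma.Site d) + s)) :=
      measurable_pi_lambda _ fun i => measurable_pi_apply _
    have hshift : Measurable fun v : I → ℝ => -(I.restrict u) + v := measurable_const.add measurable_id
    have hcomp : (fun ω : B1Eq324BenfattoLemma.Site d → ℝ => I.restrict ω) ∘ Φ =
        (fun v : I → ℝ => -(I.restrict u) + v) ∘ fun z : B1Eq324BenfattoLemma.Site d → ℝ => fun i : I => z ((i : B1Eq324BenfattoLemma.Site d) + s) := by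
      funext z
      ext i
      simp only [Function.comp_apply, Finset.restrict, hΦ, Pi.add_apply, Pi.neg_apply]
      ring
    refine ⟨?_⟩
    rw [hν, Measure.map_map hrm hΦm]
    change IsGaussian (μ.map ((fun ω : B1Eq324BenfattoLemma.Site d → ℝ => I.restrict ω) ∘ Φ))
    rw [hcomp, ← Measure.map_map hshift hRm]
    haveI : IsGaussian (μ.map fun z : B1Eq324BenfattoLemma.Site d → ℝ => fun i : I => z ((i : B1Eq324BenfattoLemma.Site d) + s)) :=
      hGI.isGaussian_map
    infer_instance
  -- (ii) centred
  have hm : ∀ x, ∫ ω, ω x ∂ν = 0 := by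
    intro x
    rw [hν, integral_map hΦm.aemeasurable (measurable_pi_apply x).aestronglyMeasurable]
    simp only [hΦ]
    rw [integral_sub (hint (x + s)) (integrable_const _), integral_eval_condField hα hβ C' zbar (x + s), hu' x, integral_const,
      probReal_univ, one_smul, sub_self]
  -- (iii) covariance `C^C`
  have hc : ∀ x y, cov[fun ω : B1Eq324BenfattoLemma.Site d → ℝ => ω x, fun ω => ω y; ν] = condCov K C x y := by
    intro x y
    rw [hν, covariance_map (measurable_pi_apply x).aestronglyMeasurable (measurable_pi_apply y).aestronglyMeasurable hΦm.aemeasurable]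
    change cov[fun z : B1Eq324BenfattoLemma.Site d → ℝ => z (x + s) - u x, fun z => z (y + s) - u y; μ] = _
    rw [show (fun z : B1Eq324BenfattoLemma.Site d → ℝ => z (x + s) - u x) = fun z => z (x + s) + (-u x) from funext fun z => by ring,
      show (fun z : B1Eq324BenfattoLemma.Site d → ℝ => z (y + s) - u y) = fun z => z (y + s) + (-u y) from funext fun z => by ring,
      covariance_add_const_left (hint (x + s)), covariance_add_const_right (hint (y + s)), hμ, covariance_eval_condField hα hβ C' zbar,
      hC', condCov_image_add]
  have hνQ : ν = Q := eq_gaussianFieldOfKernel_of_isGaussianProcess hKc hG hm hc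
  -- undo the centring
  have hid : Sp ∘ Sm = id := by
    funext z
    ext x
    simp only [Function.comp_apply, hSp, hSm, hu, id]
    ring
  calc μ.map τ = ((μ.map τ).map Sm).map Sp := by rw [Measure.map_map hSpm hSmm, hid, Measure.map_id]
    _ = ν.map Sp := by rw [hν, hΦeq, Measure.map_map hSmm hτm]
    _ = Q.map Sp := by rw [hνQ]
    _ = condField d α β C (fun y => zbar (y + s)) := rfl

/-- **Integrals against `P̄` transform accordingly**: `∫ F(z∘(·+s)) dP̂₀(·|z̄_{C+s}) = ∫ F dP̂₀(·|(z̄∘(·+s))_C)` for measurable `F`.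
[cite: BenfattoEtAl1978, p.152, §5 p.159] -/
theorem integral_condField_comp_translate (hα : 0 < α) (hβ : 0 < β) (C : Finset (B1Eq324BenfattoLemma.Site d)) (s : B1Eq324BenfattoLemma.Site d)
    (zbar : B1Eq324BenfattoLemma.Site d → ℝ) {F : (B1Eq324BenfattoLemma.Site d → ℝ) → ℝ} (hF : Measurable F) :
    ∫ z, F (fun x => z (x + s)) ∂condField d α β (C.image fun x => x + s) zbar = ∫ z, F z ∂condField d α β C (fun y => zbar (y + s)) := by
  rw [← condField_map_translate hα hβ C s zbar, integral_map (measurable_translate' s).aemeasurable hF.aestronglyMeasurable]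

end Law

end Literature.MathematicalPhysics.QuantumFieldTheory.Balaban1983to89.B1Eq324BenfattoCondTranslation

end
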